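import Summits.KontsevichZagierPeriods.KontsevichZagierPeriods.Theorems.TerasomaMultiplicationBetaCancellationStubTameFormAux16
import Literature.NumberTheory.Transcendental.KZSemiCanonicalReductionProofs

/-!
# `BetaCancellation` (stmt-KontsevichZagierPeriods-13633), line `divisor-slicing-transshipment` — stub `stub_tameForm`, auxiliary file 17: the representations of the normal form

Integral representations realising the measured sets of the normal form, with their relations:

* `exists_stabRep` — the stabilisation `Z × (0,1)ᴺ⁻ⁿ` of a representation `Z` is a representation
  (domain `stabSet h Z.domain`, integrand `stabFun h Z.integrand`) equivalent to `Z` (slabs are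
  Newton–Leibniz moves, `KZ.IntegralRep.equivalent_slab`; open versus closed unit interval is a null
  modification);
* `exists_posRep`, `exists_negRep` — the positive part `(posSet Z, f)` and the sign-flipped
  negative part `(negSet Z, −f)` of a representation, with `[Z] ≡ [Z₊] − [Z₋]`;
* `exists_tildeRep` — the absorbed spectator `s̃ = s × (0,1) × (0,2)` of auxiliary file 15 is a
  representation whenever `(s, ρ)` is (`IntegralRep.prod` with a box, `IntegralRep.reindex`).

References: M. Kontsevich, D. Zagier, *Periods* (2001), §1.2; crux NOTES c6 (F13).
-/

noncomputable section

-- `Summit.KontsevichZagierPeriods.KontsevichZagierPeriods.…` is the tree's mandated layout (single-conjunct summit).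
set_option linter.dupNamespace false

namespace Summit.KontsevichZagierPeriods.KontsevichZagierPeriods.BetaCancellationDivisorSlicing

open MeasureTheory Set Function
open Literature.NumberTheory.Transcendental
open Literature.NumberTheory.Transcendental.KZ
open Literature.ModelTheory.ExponentialFields (IsSemialgebraic isSemialgebraic_univ)

variable {n N : ℕ}

/-! ### Stabilised representations -/

/-- One more coordinate: a representation with domain `stabSet (once) Z.domain` and integrand
`Z.integrand ∘ init`, equivalent to `Z` (a slab move followed by a null modification). [folklore] -/
theorem exists_stabRep_succ (Z : IntegralRep n) :
    ∃ Zs : IntegralRep (n + 1), Zs.domain = stabSet n.le_succ Z.domain ∧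
      Zs.integrand = stabFun n.le_succ Z.integrand ∧ of Z - of Zs ∈ relations := by
  have hsub : stabSet n.le_succ Z.domain ⊆ (Z.slab 0).domain := by
    intro z hz
    rw [mem_stabSet_succ] at hz
    rw [IntegralRep.domain_slab]
    exact ⟨hz.1, by simpa using hz.2.1.le, by simpa using hz.2.2.le⟩
  have hsa : IsSemialgebraic ℚ (stabSet n.le_succ Z.domain) := isSemialgebraic_stabSet _ Z.isSemialgebraic_domain
  let Zs : IntegralRep (n + 1) := (Z.slab 0).restrict _ hsa hsub
  refine ⟨Zs, rfl, rfl, ?_⟩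
  have h1 : of Z - of (Z.slab 0) ∈ relations := Z.equivalent_slab 0
  have h2 : of (Z.slab 0) - of Zs ∈ relations := by
    refine (Z.slab 0).of_sub_of_restrict_mem_relations hsa hsub ?_
    have hcov : (Z.slab 0).domain \ stabSet n.le_succ Z.domain ⊆
        {z : Fin (n + 1) → ℝ | z (Fin.last n) = 0} ∪ {z : Fin (n + 1) → ℝ | z (Fin.last n) = 1} := by
      intro z hz
      rw [IntegralRep.domain_slab] at hz
      obtain ⟨⟨hzd, h0, h1⟩, hz'⟩ := hz
      simp only [Nat.cast_zero, zero_add] at h0 h1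
      rw [mem_stabSet_succ, not_and, mem_Ioo, not_and_or, not_lt, not_lt] at hz'
      rcases hz' hzd with h | h
      · exact Or.inl (le_antisymm h h0)
      · exact Or.inr (le_antisymm h1 h)
    exact measure_mono_null hcov (measure_union_null (volume_setOf_last_eq_zero 0)
      (volume_setOf_last_eq_zero 1))
  have : of Z - of Zs = (of Z - of (Z.slab 0)) + (of (Z.slab 0) - of Zs) := by abel
  rw [this]
  exact relations.add_mem h1 h2

/-- **Stabilised representations**: for `Z` in dimension `n` and `n ≤ N` there is a representation
with domain `stabSet h Z.domain` and integrand `stabFun h Z.integrand`, equivalent to `Z`. [folklore] -/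
theorem exists_stabRep (Z : IntegralRep n) (h : n ≤ N) :
    ∃ Zs : IntegralRep N, Zs.domain = stabSet h Z.domain ∧ Zs.integrand = stabFun h Z.integrand ∧
      of Z - of Zs ∈ relations := by
  induction N, h using Nat.le_induction with
  | base => exact ⟨Z, (stabSet_rfl _).symm, (stabFun_rfl _).symm, by simp⟩
  | succ N h ih =>
    obtain ⟨Zs, hd, hi, hrel⟩ := ih
    obtain ⟨Zs', hd', hi', hrel'⟩ := exists_stabRep_succ Zs
    refine ⟨Zs', ?_, ?_, ?_⟩
    · rw [hd', hd, stabSet_stabSet]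
    · rw [hi', hi, stabFun_stabFun]
    · have : of Z - of Zs' = (of Z - of Zs) + (of Zs - of Zs') := by abel
      rw [this]
      exact relations.add_mem hrel hrel'

/-! ### Positive and negative parts as representations -/

/-- The positive part of a representation as a representation. [folklore] -/
theorem exists_posRep (Z : IntegralRep n) :
    ∃ P : IntegralRep n, P.domain = posSet Z ∧ P.integrand = Z.integrand :=
  ⟨Z.restrict _ (isSemialgebraic_posSet Z) (posSet_subset Z), rfl, rfl⟩

/-- The sign-flipped negative part of a representation as a representation. [folklore] -/
theorem exists_negRep (Z : IntegralRep n) :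
    ∃ M : IntegralRep n, M.domain = negSet Z ∧ M.integrand = -Z.integrand :=
  ⟨(Z.restrict _ (isSemialgebraic_negSet Z) (negSet_subset Z)).neg, rfl, rfl⟩

/-- **`[Z] ≡ [Z₊] − [Z₋]`**: a representation is, modulo relations, its positive part minus its
sign-flipped negative part (the zero part is a relation). [cite: KontsevichZagier2001, §1.2 rule (1)] -/
theorem of_sub_pos_add_neg_mem_relations (Z P M : IntegralRep n) (hP : P.domain = posSet Z)
    (hPi : P.integrand = Z.integrand) (hM : M.domain = negSet Z) (hMi : M.integrand = -Z.integrand) :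
    of Z - (of P - of M) ∈ relations := by
  have h0s : IsSemialgebraic ℚ {x | x ∈ Z.domain ∧ Z.integrand x = 0} :=
    isSemialgebraic_sep_zero Z.isSemialgebraicFunOn_integrand
  have hles : IsSemialgebraic ℚ {x | x ∈ Z.domain ∧ Z.integrand x ≤ 0} := by
    convert Z.isSemialgebraic_domain.diff (isSemialgebraic_posSet Z) using 1
    ext x
    simp only [mem_setOf_eq, Set.mem_sdiff, mem_posSet, not_and, not_lt]
    exact ⟨fun h => ⟨h.1, fun _ => h.2⟩, fun h => ⟨h.1, h.2 h.1⟩⟩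
  let Zp := Z.restrict _ (isSemialgebraic_posSet Z) (posSet_subset Z)
  let Zle := Z.restrict _ hles (fun x hx => hx.1)
  let Zn := Z.restrict _ (isSemialgebraic_negSet Z) (negSet_subset Z)
  let Z₀ := Z.restrict _ h0s (fun x hx => hx.1)
  have h1 : of Z - of Zp - of Zle ∈ relations := by
    refine domainAddRel_subset_relations ⟨n, Z, Zp, Zle, ?_, ?_, fun _ _ => rfl, fun _ _ => rfl, rfl⟩
    · ext x
      simp only [Zp, Zle, IntegralRep.domain_restrict, mem_union, mem_posSet, mem_setOf_eq]
      constructor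
      · intro hx
        rcases lt_or_ge 0 (Z.integrand x) with h | h
        · exact Or.inl ⟨hx, h⟩
        · exact Or.inr ⟨hx, h⟩
      · rintro (h | h) <;> exact h.1
    · refine measure_mono_null (fun x hx => ?_) measure_empty
      simp only [Zp, Zle, IntegralRep.domain_restrict, mem_inter_iff, mem_posSet, mem_setOf_eq] at hx
      linarith [hx.1.2, hx.2.2]
  have h2 : of Zle - of Zn - of Z₀ ∈ relations := by
    refine domainAddRel_subset_relations ⟨n, Zle, Zn, Z₀, ?_, ?_, fun _ _ => rfl, fun _ _ => rfl, rfl⟩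
    · ext x
      simp only [Zle, Zn, Z₀, IntegralRep.domain_restrict, mem_union, mem_negSet, mem_setOf_eq]
      constructor
      · intro hx
        rcases lt_or_eq_of_le hx.2 with h | h
        · exact Or.inl ⟨hx.1, h⟩
        · exact Or.inr ⟨hx.1, h⟩
      · rintro (h | h)
        · exact ⟨h.1, h.2.le⟩
        · exact ⟨h.1, h.2.le⟩
    · refine measure_mono_null (fun x hx => ?_) measure_empty
      simp only [Zn, Z₀, IntegralRep.domain_restrict, mem_inter_iff, mem_negSet, mem_setOf_eq] at hx
      linarith [hx.1.2, hx.2.2]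
  have h3 : of Z₀ ∈ relations := of_mem_relations_of_eqOn_zero Z₀ fun x hx => hx.2
  have h4 : of Zn + of M ∈ relations :=
    of_add_of_mem_relations_of_eqOn_neg (by simp [Zn, hM]) (by simp [Zn, hMi, EqOn])
  have h5 : of Zp - of P ∈ relations := of_sub_of_mem_relations_of_eqOn (by simp [Zp, hP]) (by simp [Zp, hPi, EqOn])
  have : of Z - (of P - of M) = (of Z - of Zp - of Zle) + (of Zle - of Zn - of Z₀) + of Z₀ + (of Zn + of M) +
      (of Zp - of P) := by abel
  rw [this]
  exact relations.add_mem (relations.add_mem (relations.add_mem (relations.add_mem h1 h2) h3) h4) h5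

/-! ### The absorbed spectator as a representation -/

/-- The box `(0,1) × (0,2)` as a representation of dimension `2` with integrand `1`. [folklore] -/
theorem exists_boxRep : ∃ B : IntegralRep 2, B.domain = {p : Fin 2 → ℝ | p 0 ∈ Ioo (0 : ℝ) 1 ∧ p 1 ∈ Ioo (0 : ℝ) 2} ∧
    B.integrand = fun _ => 1 := by
  have hsa : IsSemialgebraic ℚ {p : Fin 2 → ℝ | p 0 ∈ Ioo (0 : ℝ) 1 ∧ p 1 ∈ Ioo (0 : ℝ) 2} := by
    have h0 := Literature.ModelTheory.ExponentialFields.isSemialgebraic_setOf_eval_lt (k := ℚ) (R := ℝ)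
      (0 : MvPolynomial (Fin 2) ℚ) (MvPolynomial.X 0)
    have h1 := Literature.ModelTheory.ExponentialFields.isSemialgebraic_setOf_eval_lt (k := ℚ) (R := ℝ)
      (MvPolynomial.X 0) (1 : MvPolynomial (Fin 2) ℚ)
    have h2 := Literature.ModelTheory.ExponentialFields.isSemialgebraic_setOf_eval_lt (k := ℚ) (R := ℝ)
      (0 : MvPolynomial (Fin 2) ℚ) (MvPolynomial.X 1)
    have h3 := Literature.ModelTheory.ExponentialFields.isSemialgebraic_setOf_eval_lt (k := ℚ) (R := ℝ)
      (MvPolynomial.X 1) (2 : MvPolynomial (Fin 2) ℚ)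
    have : {p : Fin 2 → ℝ | p 0 ∈ Ioo (0 : ℝ) 1 ∧ p 1 ∈ Ioo (0 : ℝ) 2} =
        ({x : Fin 2 → ℝ | MvPolynomial.aeval x (0 : MvPolynomial (Fin 2) ℚ) <
            MvPolynomial.aeval x (MvPolynomial.X 0 : MvPolynomial (Fin 2) ℚ)} ∩
          {x : Fin 2 → ℝ | MvPolynomial.aeval x (MvPolynomial.X 0 : MvPolynomial (Fin 2) ℚ) <
            MvPolynomial.aeval x (1 : MvPolynomial (Fin 2) ℚ)}) ∩
        ({x : Fin 2 → ℝ | MvPolynomial.aeval x (0 : MvPolynomial (Fin 2) ℚ) <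
            MvPolynomial.aeval x (MvPolynomial.X 1 : MvPolynomial (Fin 2) ℚ)} ∩
          {x : Fin 2 → ℝ | MvPolynomial.aeval x (MvPolynomial.X 1 : MvPolynomial (Fin 2) ℚ) <
            MvPolynomial.aeval x (2 : MvPolynomial (Fin 2) ℚ)}) := by
      ext p
      simp [mem_Ioo]
    rw [this]
    exact (h0.inter h1).inter (h2.inter h3)
  have hbdd : {p : Fin 2 → ℝ | p 0 ∈ Ioo (0 : ℝ) 1 ∧ p 1 ∈ Ioo (0 : ℝ) 2} ⊆ Icc (0 : Fin 2 → ℝ) (fun _ => 2) := by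
    intro p hp
    rw [mem_Icc, Pi.le_def, Pi.le_def]
    refine ⟨fun i => ?_, fun i => ?_⟩
    · fin_cases i
      · simpa using hp.1.1.le
      · simpa using hp.2.1.le
    · fin_cases i
      · have := hp.1.2; simp only [Fin.zero_eta, Fin.isValue]; linarith
      · simpa using hp.2.2.le
  have hfin : volume {p : Fin 2 → ℝ | p 0 ∈ Ioo (0 : ℝ) 1 ∧ p 1 ∈ Ioo (0 : ℝ) 2} < ⊤ :=
    (measure_mono hbdd).trans_lt (by rw [Real.volume_Icc_pi]; exact ENNReal.prod_lt_top fun _ _ => by simp)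
  refine ⟨⟨_, fun _ => 1, hsa, by simpa using isSemialgebraicFunOn_aeval hsa (1 : MvPolynomial (Fin 2) ℚ),
    integrableOn_const hfin.ne⟩, rfl, rfl⟩

/-- **The absorbed spectator `s̃ = s × (0,1) × (0,2)` as a representation** (dimension `D + 3`,
integrand `ρ` of the first `1 + D` coordinates), for `(s, ρ)` the domain and integrand of a
representation `C` of dimension `1 + D`. [folklore] -/
theorem exists_tildeRep (D : ℕ) (C : IntegralRep (1 + D)) (hD : 1 + D ≤ D + 3) :
    ∃ Ct : IntegralRep (D + 3), Ct.domain = {y : Fin (D + 3) → ℝ |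
        (fun i : Fin (1 + D) => y (Fin.castLE hD i)) ∈ C.domain ∧
          y ⟨1 + D, by omega⟩ ∈ Ioo (0 : ℝ) 1 ∧ y (Fin.last (D + 2)) ∈ Ioo (0 : ℝ) 2} ∧
      Ct.integrand = fun y => C.integrand (fun i : Fin (1 + D) => y (Fin.castLE hD i)) := by
  obtain ⟨B, hBd, hBi⟩ := exists_boxRep
  let e : Fin (1 + D + 2) ≃ Fin (D + 3) := finCongr (by omega)
  refine ⟨(C.prod B).reindex e, ?_, ?_⟩
  · ext y
    simp only [IntegralRep.reindex_domain, IntegralRep.prod_domain, IntegralRep.mem_prodDomain, hBd,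
      mem_setOf_eq]
    have h1 : (fun i : Fin (1 + D) => y (e (Fin.castAdd 2 i))) = fun i => y (Fin.castLE hD i) := by
      funext i; congr 1
    have h2 : e (Fin.natAdd (1 + D) 0) = ⟨1 + D, by omega⟩ := Fin.ext (by simp [e]; omega)
    have h3 : e (Fin.natAdd (1 + D) 1) = Fin.last (D + 2) := Fin.ext (by simp [e])
    rw [h1, h2, h3]
  · funext y
    simp only [IntegralRep.reindex_integrand, IntegralRep.prod_integrand_eq, IntegralRep.prodFun_apply, hBi,
      mul_one]
    rfl

/-! ### Headline -/

/-- Registered helper goal of the stub `stub_tameForm`: stabilised representations exist and are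
equivalent to the original. [folklore] -/
theorem tameForm_aux_stabRep : ∀ {n N : ℕ} (Z : IntegralRep n) (h : n ≤ N), ∃ Zs : IntegralRep N, Zs.domain = stabSet h Z.domain ∧ Zs.integrand = stabFun h Z.integrand ∧ of Z - of Zs ∈ relations :=
  fun Z h => exists_stabRep Z h

end Summit.KontsevichZagierPeriods.KontsevichZagierPeriods.BetaCancellationDivisorSlicing

end
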